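import Summits.BirchSwinnertonDyer.Rank1Residual.Additive.X4RankZeroCyclotomicThree
import Summits.BirchSwinnertonDyer.Rank1Residual.Additive.XMultRankZeroCyclotomicThreeX4Facts
import Summits.BirchSwinnertonDyer.Rank1Residual.Additive.XSplitMultRankZeroCyclotomicThreeX4Facts
import Summits.BirchSwinnertonDyer.Rank1Residual.AdditivePotMult.PStarTwistModel
import HarnessLib

/-!
# X4 at `p = 3`, CLASS LEVEL, ranks `(0,0)`: one statement for every irreducible additive pair `(W, 3)`
# with `surj(3) ∧ ram(3)` whose twist `V = W^{(−3)}` is ORDINARY-SEMISTABLE at `3`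
# (cells (M) and (G-ord, `e = 2`, `V` ordinary) of the census)

HONEST FRAMING (cell `b2b-bsdres`, run/shared/lean/b2b/bsd-rank1-residual/, verbatim in every
file): the goal of the cell is to DELETE the COMBINATION-SHAPED residual classes of the
Birch–Swinnerton-Dyer formula for ALL analytic-rank `≤ 1` elliptic curves over `ℚ` — "full BSD
formula for every rank `≤ 1` curve in class `C`" assembled STRICTLY from published theorems — so
that the rank-`≤ 1` remainder becomes exactly the CONSTRUCTION-SHAPED classes, which are TYPED
(missing-input `Prop`s), NOT attempted. This is not "finishing BSD". Seat additive-p4 (research route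
on the construction-shaped classes X3/X4), gen 7; the X4 label is UNCHANGED by this file; nothing is
booked here (the referee rules on bookings).

Theorems only (no `def`, no `sorry`, no new named fact). The X4 twin of
`X3SemistableTwistRankZeroThreeClass.lean`: lines V14b (twist good ordinary, Kato Astérisque 295
Thm. 17.4 (3) over `ℚ(ζ₃)`, `X4RankZeroCyclotomicThree`), V15 (twist non-split multiplicative, Kato's
divisibility as attributed by Wuthrich Thm. 3 / Cor. 19, `XMultRankZeroCyclotomicThreeX4Facts`) and V16
(twist split multiplicative, exceptional zero, `XSplitMultRankZeroCyclotomicThreeX4Facts`) each prove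
`ord₃ #Ш(V) + ord₃ #Ш(W) ≤ ord₃ #Ш_an(V) + ord₃ #Ш_an(W)` for an additive `W ≅ V^{(−3)}` with image
hypothesis `surj(3) ∧ ram(3)` on `W` (census bits; `ρ_{V,3^∞}` onto by `TwistRamTransport`). This file
states the union ONCE at the level of the cell's EXACT class predicate
`ClassX4 W 3 = (3 ≠ 2) ∧ Addv W 3 ∧ Irr W 3` (`Literature/…/Rank1Residual/Predicates.lean`), for the
partition table: per-row data left = the twist datum `C • V^{(−3)} = W` with `V` globally minimal and
ORDINARY-SEMISTABLE at `3` (`IsOrdinaryAt V 3 ∨ Mult V 3`; unlike X3, a good twist of an X4 curve CAN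
be supersingular — 130 census rows, line V14e, out of reach of the ordinary theory), the bits
`surj(3)`, `ram(3)`, the two analytic ranks and the two unit bits. On the (M)-cell `Mult V 3` is a
theorem of additive-p1 (`ClassX4M.mult_of_twist_model_negThree`): `ClassX4M.…` corollaries.

* `ClassX4.exists_padicVal_shaOrder_add_le_three_of_ordSemistableTwist` — the sum inequality;
* `ClassX4.missingUpperBoundAt_three_of_ordSemistableTwist` — `3 ∤ #Ш_an(V)` ⇒ `Typed.MissingUpperBoundAt W 3`;
* `ClassX4.bsdp_three_of_ordSemistableTwist_of_shaAn_units` — doubly-unit rows ⇒ `BSD(W,3) ∧ BSD(V,3)`;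
* `ClassX4M.exists_padicVal_shaOrder_add_le_three`, `ClassX4M.bsdp_three_of_shaAn_units`.

Census (hyp two-engine table `b2b-bsdres-hyp/hyp/cyc3/cyc3_two_engine.tsv`, `N < 2·10⁴`): X4
rank-`(0,0)` rows at `p = 3` with ordinary-semistable twist: (G-ord, `V` ordinary) 62 + (M, non-split)
208 + (M, split) 202 = 472 CORE-open rows; with `surj(3) ∧ ram(3)` and doubly-unit: 56 + 191 + 169 =
416 reach `BSD₃(W) ∧ BSD₃(V)`.
-/

noncomputable section

open scoped Classical

open WeierstrassCurve Literature.NumberTheory.EllipticCurves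
  Literature.NumberTheory.EllipticCurves.ModularForms
  Literature.NumberTheory.EllipticCurves.Rank1Residual
  Literature.NumberTheory.EllipticCurves.Rank1Residual.Typed
  Summit.BirchSwinnertonDyer.Rank1Residual.AdditivePotMult

namespace Summit.BirchSwinnertonDyer.Rank1Residual.Additive

variable (V : WeierstrassCurve ℚ) [V.IsElliptic] [V.IsGloballyMinimal]
  (W : WeierstrassCurve ℚ) [W.IsElliptic] [W.IsGloballyMinimal]

/-- **X4 at `p = 3`, class level, ranks `(0,0)`: the sum inequality.** Let `(W, 3)` be an X4 pair
(`ClassX4 W 3`: `W[3]` irreducible, `W` additive at `3`, `W` globally minimal) with census bits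
`surj(3)` (`ρ̄_{W,3}` onto) and `ram(3)` (a multiplicative prime `ℓ ≠ 3` of `W` with `3 ∤ v_ℓ(Δ)`), and `V`
a globally minimal curve with `C • V^{(−3)} = W` which is ORDINARY-SEMISTABLE at `3`
(`IsOrdinaryAt V 3 ∨ Mult V 3`), both of analytic rank `0`. Then `#Ш_an(V) = q_V`, `#Ш_an(W) = q_W`
are rationals with **`ord₃ #Ш(V) + ord₃ #Ш(W) ≤ ord₃ q_V + ord₃ q_W`**, granted the named published facts
of lines V14b/V15/V16: Kato Astérisque 295 Thm. 17.4 (3) over `ℚ(ζ₃)` (`hKato`), Kato's divisibility as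
attributed by Wuthrich 2014 Thm. 3 / Cor. 19 at a non-split / split multiplicative `3` (`hKatons`,
`hKatos`), Greenberg LNM 1716 Thm. 4.1 / pp. 112–113 over a number field (`hGr`, `hGrns`, `hGrs`),
Greenberg–Stevens for `V` (`hGS`, split case only), Milne 1972 (`hMilne`), modularity (`hmod`,
`hmodD`), Gross–Zagier–Kolyvagin (`hGZK`); split / non-split decided internally.
[cite: Kato2004Asterisque, Thm. 17.4 (3) (p. 273)] [cite: Wuthrich2014, Thm. 3 (p. 383) and Cor. 19 (pp. 398–399)]
[cite: GreenbergLNM1716, Thm. 4.1 (p. 102) and §4 pp. 112–113] [cite: Milne1972ArithmeticAV, §1 Thm. 1] -/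
theorem ClassX4.exists_padicVal_shaOrder_add_le_three_of_ordSemistableTwist
    (hKato : Kato2004.charIdeal_dvd_padicLFunction_cyclotomicThree_of_surjective)
    (hKatons : Wuthrich2014.kato_charIdeal_dvd_nonsplitMultiplicative_cyclotomicThree_of_surjective)
    (hKatos : Wuthrich2014.kato_charIdeal_dvd_splitMultiplicative_cyclotomicThree_of_surjective)
    (hGr : Greenberg1999.thm41_charValue_rankZero_numberField)
    (hGrns : Greenberg1999.thm41Analogue_charValue_rankZero_numberField)
    (hGrs : Greenberg1999.thm41Analogue_charValue_rankZero_split_baseChange)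
    (hGS : greenberg_stevens V 3)
    (hMilne : Milne1972.bsdQuotient_baseChange_quadratic_anyModel)
    (hGZK : rank_eq_analyticRank_of_analyticRank_le_one) (hmod : hasEntireLFunction_rat)
    (hmodD : nonempty_modularParametrizationData)
    (hX : ClassX4 W 3) (hsurj : Surj W 3) (hram : Ram W 3)
    (C : VariableChange ℚ) (hC : C • V.quadraticTwist (-(3 : ℚ)) = W)
    (hsst : IsOrdinaryAt V 3 ∨ V.HasMultiplicativeReductionAtPrime 3)
    (hrV : V.analyticRank = 0) (hrW : W.analyticRank = 0) :
    ∃ qV qW : ℚ, shaAn V = (qV : ℂ) ∧ shaAn W = (qW : ℂ) ∧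
      (padicValNat 3 V.shaOrder : ℤ) + padicValNat 3 W.shaOrder ≤ padicValRat 3 qV + padicValRat 3 qW := by
  have hadd : Addv W 3 := hX.2.1
  rcases hsst with hord | hmult
  · exact X4CyclotomicThree.exists_padicVal_shaOrder_add_le_of_surj_of_ram V W hKato hGr hMilne hGZK hmod
      hmodD C hC hord hsurj hram hadd hrV hrW
  · by_cases hsplit : V.HasSplitMultiplicativeReductionAtPrime 3
    · exact XSplitMultCyclotomicThree.exists_padicVal_shaOrder_add_le_of_facts_of_surj_of_ram V W hKatos
        hGrs hGS hMilne hGZK hmod hmodD C hC hsplit hsurj hram hadd hrV hrW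
    · exact XMultCyclotomicThree.exists_padicVal_shaOrder_add_le_of_facts_of_surj_of_ram V W hKatons hGrns
        hMilne hGZK hmod hmodD C hC hmult hsplit hsurj hram hadd hrV hrW

/-- **X4 at `p = 3`, class level: the cell's typed UPPER half for the additive curve.** In the
situation of `ClassX4.exists_padicVal_shaOrder_add_le_three_of_ordSemistableTwist`, if `#Ш_an(V)` has
non-positive `3`-adic valuation then `Typed.MissingUpperBoundAt W 3`.
[cite: Kato2004Asterisque, Thm. 17.4 (3) (p. 273)] [cite: Wuthrich2014, Thm. 3 (p. 383) and Cor. 19 (pp. 398–399)]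
[cite: GreenbergLNM1716, Thm. 4.1 (p. 102) and §4 pp. 112–113] -/
theorem ClassX4.missingUpperBoundAt_three_of_ordSemistableTwist
    (hKato : Kato2004.charIdeal_dvd_padicLFunction_cyclotomicThree_of_surjective)
    (hKatons : Wuthrich2014.kato_charIdeal_dvd_nonsplitMultiplicative_cyclotomicThree_of_surjective)
    (hKatos : Wuthrich2014.kato_charIdeal_dvd_splitMultiplicative_cyclotomicThree_of_surjective)
    (hGr : Greenberg1999.thm41_charValue_rankZero_numberField)
    (hGrns : Greenberg1999.thm41Analogue_charValue_rankZero_numberField)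
    (hGrs : Greenberg1999.thm41Analogue_charValue_rankZero_split_baseChange)
    (hGS : greenberg_stevens V 3)
    (hMilne : Milne1972.bsdQuotient_baseChange_quadratic_anyModel)
    (hGZK : rank_eq_analyticRank_of_analyticRank_le_one) (hmod : hasEntireLFunction_rat)
    (hmodD : nonempty_modularParametrizationData)
    (hX : ClassX4 W 3) (hsurj : Surj W 3) (hram : Ram W 3)
    (C : VariableChange ℚ) (hC : C • V.quadraticTwist (-(3 : ℚ)) = W)
    (hsst : IsOrdinaryAt V 3 ∨ V.HasMultiplicativeReductionAtPrime 3)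
    (hrV : V.analyticRank = 0) (hrW : W.analyticRank = 0)
    {qV : ℚ} (hqV : shaAn V = (qV : ℂ)) (hv : padicValRat 3 qV ≤ 0) :
    MissingUpperBoundAt W 3 := by
  obtain ⟨qV', qW, hqV', hqW, hle⟩ := ClassX4.exists_padicVal_shaOrder_add_le_three_of_ordSemistableTwist V W
    hKato hKatons hKatos hGr hGrns hGrs hGS hMilne hGZK hmod hmodD hX hsurj hram C hC hsst hrV hrW
  have hqq : qV' = qV := by exact_mod_cast hqV'.symm.trans hqV
  subst hqq
  refine ⟨qW, hqW, ?_⟩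
  have h0 : (0 : ℤ) ≤ padicValNat 3 V.shaOrder := by positivity
  linarith

/-- **X4 at `p = 3`, class level: `BSD(W,3) ∧ BSD(V,3)` on the doubly-unit rank-`(0,0)` rows.** In the
situation of `ClassX4.exists_padicVal_shaOrder_add_le_three_of_ordSemistableTwist`, if `#Ш_an(V)` and
`#Ш_an(W)` are `3`-adic units then Miller's `BSD(W,3)` (the ADDITIVE X4 pair) and `BSD(V,3)` (its
semistable big-image twist pair) hold simultaneously. Census (hyp cyc3 two-engine, `N < 2·10⁴`): 416 of
the 472 CORE-open rank-`(0,0)` X4 rows at `p = 3` with ordinary-semistable twist carry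
`surj(3) ∧ ram(3)` and both unit bits. Labels UNCHANGED; nothing booked by this theorem.
[cite: Kato2004Asterisque, Thm. 17.4 (3) (p. 273)] [cite: Wuthrich2014, Thm. 3 (p. 383) and Cor. 19 (pp. 398–399)]
[cite: GreenbergLNM1716, Thm. 4.1 (p. 102) and §4 pp. 112–113] [cite: Miller2011LMS, §1 and Def. 1.1] -/
theorem ClassX4.bsdp_three_of_ordSemistableTwist_of_shaAn_units
    (hKato : Kato2004.charIdeal_dvd_padicLFunction_cyclotomicThree_of_surjective)
    (hKatons : Wuthrich2014.kato_charIdeal_dvd_nonsplitMultiplicative_cyclotomicThree_of_surjective)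
    (hKatos : Wuthrich2014.kato_charIdeal_dvd_splitMultiplicative_cyclotomicThree_of_surjective)
    (hGr : Greenberg1999.thm41_charValue_rankZero_numberField)
    (hGrns : Greenberg1999.thm41Analogue_charValue_rankZero_numberField)
    (hGrs : Greenberg1999.thm41Analogue_charValue_rankZero_split_baseChange)
    (hGS : greenberg_stevens V 3)
    (hMilne : Milne1972.bsdQuotient_baseChange_quadratic_anyModel)
    (hGZK : rank_eq_analyticRank_of_analyticRank_le_one) (hmod : hasEntireLFunction_rat)
    (hmodD : nonempty_modularParametrizationData)
    (hX : ClassX4 W 3) (hsurj : Surj W 3) (hram : Ram W 3)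
    (C : VariableChange ℚ) (hC : C • V.quadraticTwist (-(3 : ℚ)) = W)
    (hsst : IsOrdinaryAt V 3 ∨ V.HasMultiplicativeReductionAtPrime 3)
    (hrV : V.analyticRank = 0) (hrW : W.analyticRank = 0)
    {qV qW : ℚ} (hqV : shaAn V = (qV : ℂ)) (hqW : shaAn W = (qW : ℂ))
    (hvV : padicValRat 3 qV = 0) (hvW : padicValRat 3 qW = 0) : BSDp W 3 ∧ BSDp V 3 := by
  obtain ⟨qV', qW', hqV', hqW', hle⟩ :=
    ClassX4.exists_padicVal_shaOrder_add_le_three_of_ordSemistableTwist V W hKato hKatons hKatos hGr hGrns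
      hGrs hGS hMilne hGZK hmod hmodD hX hsurj hram C hC hsst hrV hrW
  have hqq : qV' = qV := by exact_mod_cast hqV'.symm.trans hqV
  have hqq' : qW' = qW := by exact_mod_cast hqW'.symm.trans hqW
  subst hqq hqq'
  rw [hvV, hvW, add_zero] at hle
  have hV0 : (0 : ℤ) ≤ padicValNat 3 V.shaOrder := by positivity
  have hW0 : (0 : ℤ) ≤ padicValNat 3 W.shaOrder := by positivity
  have huW : MissingUpperBoundAt W 3 := ⟨qW', hqW', by rw [hvW]; linarith⟩
  have huV : MissingUpperBoundAt V 3 := ⟨qV', hqV', by rw [hvV]; linarith⟩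
  exact ⟨bsdp_of_missingPPartAt W 3 hGZK (by rw [hrW]; exact zero_le_one)
      (missingPPartAt_of_upper_of_shaAn_unit W 3 huW hqW' hvW),
    bsdp_of_missingPPartAt V 3 hGZK (by rw [hrV]; exact zero_le_one)
      (missingPPartAt_of_upper_of_shaAn_unit V 3 huV hqV' hvV)⟩

/-! ### The (M)-cell: `Mult V 3` is a theorem of additive-p1 (`ClassX4M.mult_of_twist_model_negThree`) -/

/-- **X4(M) at `p = 3`, ranks `(0,0)`: the sum inequality with NO reduction datum on the twist.** For
`W` in additive-p1's class `ClassX4M W 3` (`ClassX4 W 3 ∧ v₃(j) < 0`) with `surj(3) ∧ ram(3)` and ANY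
globally minimal `V` with `C • V^{(−3)} = W`, both of analytic rank `0`:
`ord₃ #Ш(V) + ord₃ #Ш(W) ≤ ord₃ #Ш_an(V) + ord₃ #Ш_an(W)` from the named facts of lines V15/V16.
[cite: Wuthrich2014, Thm. 3 (p. 383) and Cor. 19 (pp. 398–399)] [cite: GreenbergLNM1716, §4 pp. 112–113]
[cite: SilvermanATAEC1994, V.5.3] -/
theorem ClassX4M.exists_padicVal_shaOrder_add_le_three
    (hKatons : Wuthrich2014.kato_charIdeal_dvd_nonsplitMultiplicative_cyclotomicThree_of_surjective)
    (hKatos : Wuthrich2014.kato_charIdeal_dvd_splitMultiplicative_cyclotomicThree_of_surjective)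
    (hGrns : Greenberg1999.thm41Analogue_charValue_rankZero_numberField)
    (hGrs : Greenberg1999.thm41Analogue_charValue_rankZero_split_baseChange)
    (hGS : greenberg_stevens V 3)
    (hMilne : Milne1972.bsdQuotient_baseChange_quadratic_anyModel)
    (hGZK : rank_eq_analyticRank_of_analyticRank_le_one) (hmod : hasEntireLFunction_rat)
    (hmodD : nonempty_modularParametrizationData)
    (hX : ClassX4M W 3) (hsurj : Surj W 3) (hram : Ram W 3)
    (C : VariableChange ℚ) (hC : C • V.quadraticTwist (-(3 : ℚ)) = W)
    (hrV : V.analyticRank = 0) (hrW : W.analyticRank = 0) :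
    ∃ qV qW : ℚ, shaAn V = (qV : ℂ) ∧ shaAn W = (qW : ℂ) ∧
      (padicValNat 3 V.shaOrder : ℤ) + padicValNat 3 W.shaOrder ≤ padicValRat 3 qV + padicValRat 3 qW := by
  have hmult : V.HasMultiplicativeReductionAtPrime 3 := ClassX4M.mult_of_twist_model_negThree hX V C hC
  have hadd : Addv W 3 := hX.1.2.1
  by_cases hsplit : V.HasSplitMultiplicativeReductionAtPrime 3
  · exact XSplitMultCyclotomicThree.exists_padicVal_shaOrder_add_le_of_facts_of_surj_of_ram V W hKatos
      hGrs hGS hMilne hGZK hmod hmodD C hC hsplit hsurj hram hadd hrV hrW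
  · exact XMultCyclotomicThree.exists_padicVal_shaOrder_add_le_of_facts_of_surj_of_ram V W hKatons hGrns
      hMilne hGZK hmod hmodD C hC hmult hsplit hsurj hram hadd hrV hrW

/-- **X4(M) at `p = 3`: `BSD(W,3) ∧ BSD(V,3)` on the doubly-unit rank-`(0,0)` rows with
`surj(3) ∧ ram(3)`**, class-level form of the V15/V16 X4 corollaries with the multiplicativity of the
twist discharged. Census (hyp cyc3, `N < 2·10⁴`): 191 + 169 = 360 of the 410 CORE-open rank-`(0,0)`
X4 ∧ (M) rows at `p = 3`. Labels UNCHANGED; nothing booked.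
[cite: Wuthrich2014, Thm. 3 (p. 383) and Cor. 19 (pp. 398–399)] [cite: GreenbergLNM1716, §4 pp. 112–113]
[cite: Miller2011LMS, §1 and Def. 1.1] -/
theorem ClassX4M.bsdp_three_of_shaAn_units
    (hKatons : Wuthrich2014.kato_charIdeal_dvd_nonsplitMultiplicative_cyclotomicThree_of_surjective)
    (hKatos : Wuthrich2014.kato_charIdeal_dvd_splitMultiplicative_cyclotomicThree_of_surjective)
    (hGrns : Greenberg1999.thm41Analogue_charValue_rankZero_numberField)
    (hGrs : Greenberg1999.thm41Analogue_charValue_rankZero_split_baseChange)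
    (hGS : greenberg_stevens V 3)
    (hMilne : Milne1972.bsdQuotient_baseChange_quadratic_anyModel)
    (hGZK : rank_eq_analyticRank_of_analyticRank_le_one) (hmod : hasEntireLFunction_rat)
    (hmodD : nonempty_modularParametrizationData)
    (hX : ClassX4M W 3) (hsurj : Surj W 3) (hram : Ram W 3)
    (C : VariableChange ℚ) (hC : C • V.quadraticTwist (-(3 : ℚ)) = W)
    (hrV : V.analyticRank = 0) (hrW : W.analyticRank = 0)
    {qV qW : ℚ} (hqV : shaAn V = (qV : ℂ)) (hqW : shaAn W = (qW : ℂ))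
    (hvV : padicValRat 3 qV = 0) (hvW : padicValRat 3 qW = 0) : BSDp W 3 ∧ BSDp V 3 := by
  obtain ⟨qV', qW', hqV', hqW', hle⟩ :=
    ClassX4M.exists_padicVal_shaOrder_add_le_three V W hKatons hKatos hGrns hGrs hGS hMilne hGZK hmod hmodD
      hX hsurj hram C hC hrV hrW
  have hqq : qV' = qV := by exact_mod_cast hqV'.symm.trans hqV
  have hqq' : qW' = qW := by exact_mod_cast hqW'.symm.trans hqW
  subst hqq hqq'
  rw [hvV, hvW, add_zero] at hle
  have hV0 : (0 : ℤ) ≤ padicValNat 3 V.shaOrder := by positivity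
  have hW0 : (0 : ℤ) ≤ padicValNat 3 W.shaOrder := by positivity
  have huW : MissingUpperBoundAt W 3 := ⟨qW', hqW', by rw [hvW]; linarith⟩
  have huV : MissingUpperBoundAt V 3 := ⟨qV', hqV', by rw [hvV]; linarith⟩
  exact ⟨bsdp_of_missingPPartAt W 3 hGZK (by rw [hrW]; exact zero_le_one)
      (missingPPartAt_of_upper_of_shaAn_unit W 3 huW hqW' hvW),
    bsdp_of_missingPPartAt V 3 hGZK (by rw [hrV]; exact zero_le_one)
      (missingPPartAt_of_upper_of_shaAn_unit V 3 huV hqV' hvV)⟩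

end Summit.BirchSwinnertonDyer.Rank1Residual.Additive

end
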